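import Summits.Ventures.Crystal3D.Theorems.StickyWulffConstantGenericWallFloorGeneralRungTubesSF
import Summits.Ventures.Crystal3D.Theorems.StickyWulffConstantGenericWallFloorNonTriadicCriterion
import HarnessLib

/-!
# The general-filling rung for irrational / non-triadic pairs WITHOUT the clean-sliver hypotheses

HONEST FRAMING. Venture `Summits/Ventures/Crystal3D` (cell `crystal3d-full`), helper for the crux
`GenericWallFloor` (stmt-Ventures-19480) of `route-Ventures-StickyWulffConstant`, REGISTERED line `WallLedgerG`,
open stub `stub_twoSlabAdhesion`.  Rung credit only; F-C1 not moved.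

`general_twoSlabAdhesion_irrational_sf`, `general_twoSlabAdhesion_nonTriadic_sf`: the criteria of
`…NonChainCriterion` / `…NonTriadicCriterion` composed with the sliver-free rung
`general_twoSlabAdhesion_nonChain_sf`.  These carry EXACTLY the hypothesis list of `stub_twoSlabAdhesion` (cell,
samples, `1`-separation, arbitrary filling; `R₀ = 20`) for every pair with one `√2 ⟪A₁ cᵢ, A₂ w⟫ ∉ ℤ[1/3]` (resp.
irrational), with conclusion `cross₁ + cross₂ ≤ D(Y) + (φ₁ + φ₂)πρ² − (2/2809)ρ² + C(1+h)ρ` and the inputs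
`KissingGap δ`, `KissingClassification δ` BY NAME.  WHAT THIS IS NOT: the stub's constant `1·π`; the `Σ3ⁿ` chain
pairs; F-C1 not moved.
-/

noncomputable section

namespace Summit.Ventures.Crystal3D.Theorems

open Summit.Ventures.Crystal3D Finset
open Literature.MathematicalPhysics.StatisticalMechanics (fccStacking contactDeficiency)
open NearIdentity
open scoped InnerProductSpace

open scoped Classical in
/-- **The general-filling rung for irrational pairs.**  See the module docstring. -/
theorem general_twoSlabAdhesion_irrational_sf {δ : ℝ} (hg : KissingGap δ) (hc : KissingClassification δ)
    (A₁ : EuclideanSpace ℝ (Fin 3) ≃ₗᵢ[ℝ] EuclideanSpace ℝ (Fin 3)) (t₁ : EuclideanSpace ℝ (Fin 3))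
    (A₂ : EuclideanSpace ℝ (Fin 3) ≃ₗᵢ[ℝ] EuclideanSpace ℝ (Fin 3)) (t₂ : EuclideanSpace ℝ (Fin 3))
    (hirr : ∃ i : Fin 3, ∃ w ∈ fccSlots, ∀ q : ℚ, Real.sqrt 2 * ⟪A₁ (cubicFrame i), A₂ w⟫_ℝ ≠ (q : ℝ)) :
    ∃ C R₀ : ℝ, 1 ≤ R₀ ∧ ∀ h : ℝ, 0 ≤ h → ∀ ρ : ℝ, R₀ ≤ ρ →
      ∀ X P₁ P₂ : Finset (EuclideanSpace ℝ (Fin 3)),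
      (∀ p ∈ X, ∀ q ∈ X, p ≠ q → 1 ≤ dist p q) → P₁ ⊆ X → P₂ ⊆ X \ P₁ →
      (∀ p ∈ X, -(2 * R₀) ≤ p 2 ∧ p 2 ≤ h + 2 * R₀ ∧ p 0 ^ 2 + p 1 ^ 2 ≤ ρ ^ 2) →
      (∀ p, p ∈ P₁ ↔ (p ∈ (fun q => A₁ q + t₁) '' fccStacking 1 (Real.sqrt (2 / 3)) ∧
        -(2 * R₀) ≤ p 2 ∧ p 2 ≤ -R₀ ∧ p 0 ^ 2 + p 1 ^ 2 ≤ ρ ^ 2)) →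
      (∀ p, p ∈ P₂ ↔ (p ∈ (fun q => A₂ q + t₂) '' fccStacking 1 (Real.sqrt (2 / 3)) ∧
        h + R₀ ≤ p 2 ∧ p 2 ≤ h + 2 * R₀ ∧ p 0 ^ 2 + p 1 ^ 2 ≤ ρ ^ 2)) →
      ((((P₁ ×ˢ (X \ P₁)).filter fun pq => dist pq.1 pq.2 = 1).card : ℕ) : ℝ) +
        ((((P₂ ×ˢ ((X \ P₁) \ P₂)).filter fun pq => dist pq.1 pq.2 = 1).card : ℕ) : ℝ) ≤
        contactDeficiency ((X \ P₁) \ P₂) +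
          (Real.sqrt 2 / 4 * ∑ᶠ w ∈ {w ∈ fccStacking 1 (Real.sqrt (2 / 3)) | ‖w‖ = 1},
              |⟪w, A₁.symm (EuclideanSpace.single (2 : Fin 3) (1 : ℝ))⟫_ℝ| +
            Real.sqrt 2 / 4 * ∑ᶠ w ∈ {w ∈ fccStacking 1 (Real.sqrt (2 / 3)) | ‖w‖ = 1},
              |⟪w, A₂.symm (EuclideanSpace.single (2 : Fin 3) (1 : ℝ))⟫_ℝ|) * Real.pi * ρ ^ 2 -
          2 / 2809 * ρ ^ 2 + C * (1 + h) * ρ := by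
  set 𝓕 : Set (EuclideanSpace ℝ (Fin 3) ≃ₗᵢ[ℝ] EuclideanSpace ℝ (Fin 3)) :=
    {G | ∀ i j : Fin 3, ∃ q : ℚ, ⟪A₁ (cubicFrame i), G (cubicFrame j)⟫_ℝ = (q : ℝ)} with h𝓕
  refine general_twoSlabAdhesion_nonChain_sf hg hc A₁ t₁ A₂ t₂ 𝓕 (rationalFrame_self A₁) ?_ ?_
  · -- avoidance
    intro G hG heq
    obtain ⟨i, w, hw, hirr⟩ := hirr
    have hA₂w : A₂ w ∈ G '' fccStacking 1 (Real.sqrt (2 / 3)) := by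
      rw [heq]; exact ⟨w, mem_fcc_of_mem_fccSlots hw, rfl⟩
    obtain ⟨y, hy, hyw⟩ := hA₂w
    have hy1 : ‖y‖ = 1 := by
      have := congrArg norm hyw
      rw [LinearIsometryEquiv.norm_map, LinearIsometryEquiv.norm_map, norm_eq_one_of_mem_fccSlots hw] at this
      exact this
    have hys : y ∈ fccSlots := mem_fccSlots_of_unit hy hy1
    obtain ⟨q, hq⟩ := rationalFrame_slot A₁ G hG i hys
    rw [hyw] at hq
    exact hirr q hq
  · -- closure
    intro G hG m _ hmenu G' hG'
    exact rationalFrame_mirror A₁ G G' hG hmenu hG'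

open scoped Classical in
/-- **The general-filling rung for non-triadic pairs** (all irrational pairs and all CSL pairs `Σ` with an
entry denominator not a power of `3`).  See the module docstring. -/
theorem general_twoSlabAdhesion_nonTriadic_sf {δ : ℝ} (hg : KissingGap δ) (hc : KissingClassification δ)
    (A₁ : EuclideanSpace ℝ (Fin 3) ≃ₗᵢ[ℝ] EuclideanSpace ℝ (Fin 3)) (t₁ : EuclideanSpace ℝ (Fin 3))
    (A₂ : EuclideanSpace ℝ (Fin 3) ≃ₗᵢ[ℝ] EuclideanSpace ℝ (Fin 3)) (t₂ : EuclideanSpace ℝ (Fin 3))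
    (hnt : ∃ i : Fin 3, ∃ w ∈ fccSlots, ∀ (a : ℤ) (n : ℕ),
      Real.sqrt 2 * ⟪A₁ (cubicFrame i), A₂ w⟫_ℝ ≠ a / 3 ^ n) :
    ∃ C R₀ : ℝ, 1 ≤ R₀ ∧ ∀ h : ℝ, 0 ≤ h → ∀ ρ : ℝ, R₀ ≤ ρ →
      ∀ X P₁ P₂ : Finset (EuclideanSpace ℝ (Fin 3)),
      (∀ p ∈ X, ∀ q ∈ X, p ≠ q → 1 ≤ dist p q) → P₁ ⊆ X → P₂ ⊆ X \ P₁ →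
      (∀ p ∈ X, -(2 * R₀) ≤ p 2 ∧ p 2 ≤ h + 2 * R₀ ∧ p 0 ^ 2 + p 1 ^ 2 ≤ ρ ^ 2) →
      (∀ p, p ∈ P₁ ↔ (p ∈ (fun q => A₁ q + t₁) '' fccStacking 1 (Real.sqrt (2 / 3)) ∧
        -(2 * R₀) ≤ p 2 ∧ p 2 ≤ -R₀ ∧ p 0 ^ 2 + p 1 ^ 2 ≤ ρ ^ 2)) →
      (∀ p, p ∈ P₂ ↔ (p ∈ (fun q => A₂ q + t₂) '' fccStacking 1 (Real.sqrt (2 / 3)) ∧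
        h + R₀ ≤ p 2 ∧ p 2 ≤ h + 2 * R₀ ∧ p 0 ^ 2 + p 1 ^ 2 ≤ ρ ^ 2)) →
      ((((P₁ ×ˢ (X \ P₁)).filter fun pq => dist pq.1 pq.2 = 1).card : ℕ) : ℝ) +
        ((((P₂ ×ˢ ((X \ P₁) \ P₂)).filter fun pq => dist pq.1 pq.2 = 1).card : ℕ) : ℝ) ≤
        contactDeficiency ((X \ P₁) \ P₂) +
          (Real.sqrt 2 / 4 * ∑ᶠ w ∈ {w ∈ fccStacking 1 (Real.sqrt (2 / 3)) | ‖w‖ = 1},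
              |⟪w, A₁.symm (EuclideanSpace.single (2 : Fin 3) (1 : ℝ))⟫_ℝ| +
            Real.sqrt 2 / 4 * ∑ᶠ w ∈ {w ∈ fccStacking 1 (Real.sqrt (2 / 3)) | ‖w‖ = 1},
              |⟪w, A₂.symm (EuclideanSpace.single (2 : Fin 3) (1 : ℝ))⟫_ℝ|) * Real.pi * ρ ^ 2 -
          2 / 2809 * ρ ^ 2 + C * (1 + h) * ρ := by
  set 𝓕 : Set (EuclideanSpace ℝ (Fin 3) ≃ₗᵢ[ℝ] EuclideanSpace ℝ (Fin 3)) :=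
    {G | ∀ i j : Fin 3, ∃ (a : ℤ) (n : ℕ), ⟪A₁ (cubicFrame i), G (cubicFrame j)⟫_ℝ = a / 3 ^ n} with h𝓕
  refine general_twoSlabAdhesion_nonChain_sf hg hc A₁ t₁ A₂ t₂ 𝓕 (triadicFrame_self A₁) ?_ ?_
  · intro G hG heq
    obtain ⟨i, w, hw, hnt⟩ := hnt
    have hA₂w : A₂ w ∈ G '' fccStacking 1 (Real.sqrt (2 / 3)) := by
      rw [heq]; exact ⟨w, mem_fcc_of_mem_fccSlots hw, rfl⟩
    obtain ⟨y, hy, hyw⟩ := hA₂w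
    have hy1 : ‖y‖ = 1 := by
      have := congrArg norm hyw
      rw [LinearIsometryEquiv.norm_map, LinearIsometryEquiv.norm_map, norm_eq_one_of_mem_fccSlots hw] at this
      exact this
    have hys : y ∈ fccSlots := mem_fccSlots_of_unit hy hy1
    obtain ⟨a, n, han⟩ := triadicFrame_slot A₁ G hG i hys
    rw [hyw] at han
    exact hnt a n han
  · intro G hG m _ hmenu G' hG'
    exact triadicFrame_mirror A₁ G G' hG hmenu hG'

end Summit.Ventures.Crystal3D.Theorems

end
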